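/-
Copyright (c) 2026 the pub-hodgecm-mathlib formalisation cell (harness21).  Prover seat hodgecm-mathlib-LH5-p02 (g2): line LH4 (Shalika pay-down of the print row
`stub_N6nsShalika`), organ ‹U-FIN› (LH4-plan (g2) DEAL BY NAME 2026-09-02T04:10:39Z); 2026-09-02.
-/
import Literature.NumberTheory.Rogawski1990.UnipotentLevelPiecesFrameCM                  -- ★ p846498 (F0P3a-p08): the `ψ = T·e(·)·T⁻¹` dictionary (`conj_localNonsplitEquiv_mem`, `conjClasses_mk_eq_iff_exists_conj`, `conj_localNonsplitEquiv_sub_one_pow_eq_zero`); brings ★ `UnitaryThreeUnipotentClassesUnramified` (`sq_zero_unipotent_cases`)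
import Literature.NumberTheory.Automorphic.UnitaryThreeUnipotentClassesRamifiedPlace     -- ★ p846845 (F0P3a-p08): `sq_zero_unipotent_cases_of_ramified_complexConj`, `exists_fixed_unit_norm_dichotomy_of_ramified_complexConj`; brings ★ `exists_uniformizer_galAdicCompletionMap_eq_neg_of_ramified`
import Literature.NumberTheory.Automorphic.UnitaryThreeRegularUnipotentClass             -- ★ (F0P3a-p08): Prop. 3.9.1 `exists_conj_eq_of_regular_unipotent` (ONE regular class, `2 ≠ 0`)
import Literature.NumberTheory.Automorphic.HyperspecialUnitaryCartanAdicCompletion       -- ★ `unramifiedLocalConjDatum_adicCompletion` (the unramified datum at an inert `w`)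
import Literature.NumberTheory.LocalFields.UnramifiedQuadraticNormAtInertPlaceValued     -- ★ p846530: units are norms at inert `w` (`exists_mul_galAdicCompletionMap_eq_of_valued_eq_one`), a `σ_w`-skew unit (`exists_galAdicCompletionMap_eq_neg_valued_eq_one`)
import HarnessLib

/-!
# ‹U-FIN›: at an ODD non-split place `v` of `L⁺`, the unipotent conjugacy classes of `G = U(Φ₃)(L⁺_v)` form a FINITE set
(Rogawski 1990, §3.9 Proposition 3.9.1 p. 32: the classes `1`, `[n(t)]` with `t ∈ (E⁰ ∖ 0) ∕ N E^×` (two of them), and ONE regular class)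

Topic `NumberTheory/Rogawski1990`; namespace `Literature.NumberTheory.Rogawski1990`.  THEOREMS ONLY (no definition, no instance, no notation, no named fact, no `sorry`);
kernel lane `--supports stmt-HodgeConjecture-24833`.  Cell `pub/hodgecm-mathlib` (D-0151), crux H413 = `stmt-HodgeConjecture-24833`; half A line LH4 (closer stub
`stub_N6ns`; post-ED. 39 print row `stub_N6nsShalika`), pay-down skeleton cand `F0_P3c_ShalikaPaydown` (LH4-plan (g2), `StubN6nsShalika.paydown.skeleton.v1`
a42538b59ca1b043), organ **‹U-FIN› `stub_ShUFin`** — this file's head has the organ's TYPE byte for byte, so the skeleton pays it by `exact`.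
HONEST LABEL: HC_CM is proved only modulo the 7 printed citations (2 remaining named inputs: hLiu418 = stmt-HodgeConjecture-24832, h413 = stmt-HodgeConjecture-24833)
until rung 0 closes; this file is count-neutral until the organ TIE (the row `stub_N6nsShalika` stays print until all four organs are ★).

WHAT.  For a CM field `L`, a finite place `v` of `L⁺` with ONE place `w` of `L` above it (`Subsingleton (PlacesOver L v)`) and `2 ∈ 𝒪_w^×`, the set of conjugacy
classes `c` of `G = (cmDatum L 3 Φ₃).Local v = U(Φ₃)(L⁺_v)` whose members are unipotent (`(γ_c − 1)³ = 0`, read on the matrix `γ_c ∈ GL₃(L ⊗ L⁺_v)`) is finite: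
`∃ S : Finset (ConjClasses G), ∀ c, c ∈ S ↔ (γ_c − 1)³ = 0`.
PROOF.  Read `G` in the one-place model `ψ = e : G ≃* U(σ_w, J₀)(L_w)` (★ `localNonsplitEquiv`; `Φ₃ ⊗ 1 = J₀` so the frame of ★ `UnipotentLevelPiecesFrameCM` is `T = 1`):
conjugacy classes of `G` are `U(σ_w, J₀)`-conjugacy classes of the `ψ(γ)` (★ `conjClasses_mk_eq_iff_exists_conj`) and `(ψ γ − 1)³ = 0` (★
`conj_localNonsplitEquiv_sub_one_pow_eq_zero`).  A unipotent `g ∈ U(σ_w, J₀)` is either SINGULAR, `(g − 1)² = 0` — then `g = 1` or `g` is conjugate to one of TWO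
transvections `n(t_a)`, `n(t_b)` (inert `w`: `n(ϖδ)`, `n(δ)` with `δ` a `σ_w`-skew unit, ★ `sq_zero_unipotent_cases` over the unramified datum ★
`unramifiedLocalConjDatum_adicCompletion` and «units are norms» ★ `exists_mul_galAdicCompletionMap_eq_of_valued_eq_one`; tamely ramified `w` (`|2|_w = 1`): `n(ϖ)`, `n(εϖ)`
with `σ_w ϖ = −ϖ` and `ε` the non-norm unit, ★ `sq_zero_unipotent_cases_of_ramified_complexConj`) — or REGULAR, and any two regular unipotents of `U(σ_w, J₀)` are
conjugate (★ `exists_conj_eq_of_regular_unipotent`, `2 ≠ 0`).  Hence the unipotent classes lie in the union of FOUR subsingletons of `ConjClasses G` — a finite set —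
and `S` is its `Set.Finite.toFinset`.  (Exactly four classes in print; finiteness is what the organ owes.)

* `unitaryThree_unipotent_conjClasses_finite_odd` — the organ ‹U-FIN› (statement = `stub_ShUFin` of the skeleton cand VERBATIM).

## References
* [Rogawski1990] J. D. Rogawski, *Automorphic Representations of Unitary Groups in Three Variables*, Ann. of Math. Stud. 123 (1990), §3.9 Proposition 3.9.1 p. 32;
  §1.10 p. 9 (`n(t)`, `u(x, z)`); §8.1 p. 112.
* [Serre1979] J.-P. Serre, *Local Fields*, GTM 67 (1979), Ch. V §2 Prop. 3 (units are norms, unramified), §3 Cor. 2 p. 86 (index two, tame).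
* [NeukirchANT1999] J. Neukirch, *Algebraic Number Theory* (1999), Ch. I §8 (`e(w|v)` and unramified primes).
* [PlatonovRapinchuk1994] V. Platonov, A. Rapinchuk, *Algebraic Groups and Number Theory* (1994), §5.1 (`U(J)(F_v) = U(σ_w, J)(E_w)` at a non-split place).
-/

set_option autoImplicit false

noncomputable section

open scoped Matrix MatrixGroups Classical ValuativeRel
open NumberField IsDedekindDomain Matrix

namespace Literature.NumberTheory.Rogawski1990

open Literature.NumberTheory.Automorphic Literature.NumberTheory.Automorphic.UnitaryGroup Literature.NumberTheory.GaloisRepresentations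
open Literature.NumberTheory.Automorphic.HermitianLattice Literature.NumberTheory.LocalFields.UnramifiedQuadraticNorm

/-! ## §1 Two local readings of the hypotheses -/

/-- At a place `v` with ONE prime of `L` above it, `v` NOT unramified in `L` forces `e(w|v) ≠ 1` for that prime (Mathlib
`Algebra.isUnramifiedIn_iff_forall_ramificationIdx_eq_one`; local copy of ★ `ramificationIdx'_ne_one_of_not_isUnramifiedIn_of_subsingleton` to keep the import
closure at the unipotent-classes files). [cite: NeukirchANT1999, Ch. I §8 Prop. (8.2)] -/
private theorem ramificationIdx'_ne_one_of_not_isUnramifiedIn_of_subsingleton_ufin (L : Type) [Field L] [NumberField L] [IsCMField L]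
    {v : HeightOneSpectrum (𝓞 ↥(maximalRealSubfield L))} (hsub : Subsingleton (UnitaryGroup.PlacesOver L v)) (w : UnitaryGroup.PlacesOver L v)
    (hv : ¬ Algebra.IsUnramifiedIn (𝓞 L) v.asIdeal) : v.asIdeal.ramificationIdx' w.1.asIdeal ≠ 1 := by
  intro he
  apply hv
  rw [Algebra.isUnramifiedIn_iff_forall_ramificationIdx_eq_one]
  intro 𝔓 _ h𝔓
  have hne : 𝔓 ≠ ⊥ := Ideal.ne_bot_of_liesOver_of_ne_bot v.ne_bot 𝔓
  let w' : HeightOneSpectrum (𝓞 L) := ⟨𝔓, inferInstance, hne⟩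
  have hw' : w'.under (𝓞 ↥(maximalRealSubfield L)) = v := HeightOneSpectrum.ext (h𝔓.over).symm
  have hww : (⟨w', hw'⟩ : UnitaryGroup.PlacesOver L v) = w := Subsingleton.elim _ _
  have h𝔓w : 𝔓 = w.1.asIdeal := by rw [← hww]
  rw [← Ideal.ramificationIdx'_eq_ramificationIdx v.asIdeal 𝔓 v.ne_bot, h𝔓w]
  exact he

/-- `2 ∈ 𝒪_w^×` in the valuation currency: `|2|_w = 1` (local copy of ★ `isUnit_two_integer_iff_valued_eq_one`, forward direction).
[cite: CasselsFrohlichANT1967, Ch. II §10] -/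
private theorem valued_two_eq_one_of_isUnit_two_ufin {L : Type} [Field L] [NumberField L] (w : HeightOneSpectrum (𝓞 L))
    (h2 : IsUnit (2 : 𝒪[w.adicCompletion L])) : Valued.v (2 : w.adicCompletion L) = 1 := by
  have key : IsUnit (2 : 𝒪[w.adicCompletion L]) ↔ Valued.v (2 : w.adicCompletion L) = 1 := by
    rw [Valuation.Integers.isUnit_iff_valuation_eq_one (Valuation.integer.integers (ValuativeRel.valuation (w.adicCompletion L))),
      (ValuativeRel.isEquiv (ValuativeRel.valuation (w.adicCompletion L)) (Valued.v : Valuation (w.adicCompletion L) _)).eq_one_iff_eq_one]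
    rfl
  exact key.1 h2

/-! ## §2 The organ ‹U-FIN› -/

/-- **ORGAN ‹U-FIN› — THE UNIPOTENT CONJUGACY CLASSES OF `U(Φ₃)(L⁺_v)` AT AN ODD NON-SPLIT PLACE FORM A FINITE SET**: for `v` non-split in the CM field `L`
(one place `w ∣ v`) with `2 ∈ 𝒪_w^×`, there is a finite set `S` of conjugacy classes of `G = (cmDatum L 3 Φ₃).Local v` with `c ∈ S ↔ (γ_c − 1)³ = 0`
(`γ_c = Quotient.out c` read in `GL₃(L ⊗ L⁺_v)`).  In print the classes are FOUR: `1`, the two transvection classes `[n(t)]`, `t ∈ (E⁰ ∖ 0) ∕ N E^×`, and the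
regular class; here: through the one-place model `ψ : G ≃* U(σ_w, J₀)(L_w)` every unipotent class is `[1]`, or pinned to one of two transvections (inert: ★
`sq_zero_unipotent_cases`; tamely ramified: ★ `sq_zero_unipotent_cases_of_ramified_complexConj`), or THE regular class (★ `exists_conj_eq_of_regular_unipotent`), so the
unipotent classes sit inside a union of four subsingletons.  Statement = organ `stub_ShUFin` of the LH4 skeleton cand `F0_P3c_ShalikaPaydown` VERBATIM.
[cite: Rogawski1990, §3.9 Proposition 3.9.1 p. 32; §8.1 p. 112] [cite: Serre1979, Ch. V §2 Prop. 3, §3 Cor. 2 p. 86] -/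
theorem unitaryThree_unipotent_conjClasses_finite_odd :
    ∀ (L : Type) [Field L] [NumberField L] [IsCMField L] (v : HeightOneSpectrum (𝓞 ↥(maximalRealSubfield L))) (w : UnitaryGroup.PlacesOver L v),
      Subsingleton (UnitaryGroup.PlacesOver L v) → IsUnit (2 : 𝒪[w.1.adicCompletion L]) →
      ∃ S : Finset (ConjClasses ((cmDatum L 3 (Matrix.of fun i j : Fin 3 => if i.val + j.val + 1 = 3 then (1 : L) else 0)).Local v)), ∀ c : ConjClasses ((cmDatum L 3 (Matrix.of fun i j : Fin 3 => if i.val + j.val + 1 = 3 then (1 : L) else 0)).Local v),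
        c ∈ S ↔ (((Quotient.out c : ((cmDatum L 3 (Matrix.of fun i j : Fin 3 => if i.val + j.val + 1 = 3 then (1 : L) else 0)).Local v)).val : GL (Fin 3) (UnitaryGroup.LocalRing L v)).val - 1) ^ 3 = 0 := by
  intro L _ _ _ v w hsub h2
  haveI : Algebra.IsQuadraticExtension ↥(maximalRealSubfield L) L := IsCMField.isQuadraticExtension L
  -- ## 0. the place `w` is fixed by complex conjugation; the local involution `σ_w`; `2 ≠ 0` in `L_w`
  have hw : IsCMField.complexConj L • w.1 = w.1 := smul_placesOver_eq_of_subsingleton L v (IsCMField.complexConj L) hsub w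
  have hcc : IsCMField.complexConj L * IsCMField.complexConj L = 1 := AlgEquiv.ext fun y => IsCMField.complexConj_apply_apply L y
  have hσσ : ∀ x : w.1.adicCompletion L, galAdicCompletionMap (L := L) (IsCMField.complexConj L) hw (galAdicCompletionMap (L := L) (IsCMField.complexConj L) hw x) = x :=
    galAdicCompletionMap_galAdicCompletionMap_of_smul_eq (IsCMField.complexConj L) w (IsCMField.complexConj_ne_one L) hw
  haveI : CharZero (w.1.adicCompletion L) := charZero_of_injective_algebraMap (algebraMap L _).injective
  have h2K : (2 : w.1.adicCompletion L) ≠ 0 := two_ne_zero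
  -- ## 1. the one-place model `ψ = e : G → U(σ_w, J₀)(L_w)` (★ FILE 2a with the frame `T = 1`: `Φ₃ ⊗ 1 = J₀`)
  obtain ⟨ψ, hψ⟩ : ∃ ψ : (cmDatum L 3 (Matrix.of fun i j : Fin 3 => if i.val + j.val + 1 = 3 then (1 : L) else 0)).Local v → GL (Fin 3) (w.1.adicCompletion L), ∀ y, ψ y =
      (1 : GL (Fin 3) (w.1.adicCompletion L)) * ((localNonsplitEquiv (IsCMField.complexConj L) (Matrix.of fun i j : Fin 3 => if i.val + j.val + 1 = 3 then (1 : L) else 0)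
        (IsCMField.complexConj_ne_one L) w hw y :
        ↥(unitaryGroupOfForm (galAdicCompletionMap (L := L) (IsCMField.complexConj L) hw) (placeForm (Matrix.of fun i j : Fin 3 => if i.val + j.val + 1 = 3 then (1 : L) else 0) w.1))) :
          GL (Fin 3) (w.1.adicCompletion L)) * (1 : GL (Fin 3) (w.1.adicCompletion L))⁻¹ :=
    ⟨_, fun _ => rfl⟩
  have hT : placeForm (Matrix.of fun i j : Fin 3 => if i.val + j.val + 1 = 3 then (1 : L) else 0) w.1 =
      formCongr (galAdicCompletionMap (L := L) (IsCMField.complexConj L) hw) (1 : GL (Fin 3) (w.1.adicCompletion L)) ((StdForm.antidiagonal 3).over (w.1.adicCompletion L)) := by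
    simp only [formCongr, placeForm, Units.val_one, Matrix.map_one _ (map_zero _) (map_one _), Matrix.transpose_one, Matrix.one_mul, Matrix.mul_one, antidiagOne_map]
    exact antidiagOne_eq_over (w.1.adicCompletion L) 3
  have hψU : ∀ y, ψ y ∈ unitaryGroupOfForm (galAdicCompletionMap (L := L) (IsCMField.complexConj L) hw) ((StdForm.antidiagonal 3).over (w.1.adicCompletion L)) :=
    fun y => by rw [hψ]; exact conj_localNonsplitEquiv_mem L _ v w hw hT y
  have hψconj : ∀ y y', ConjClasses.mk y = ConjClasses.mk y' ↔
      ∃ k : GL (Fin 3) (w.1.adicCompletion L), k ∈ unitaryGroupOfForm (galAdicCompletionMap (L := L) (IsCMField.complexConj L) hw)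
        ((StdForm.antidiagonal 3).over (w.1.adicCompletion L)) ∧ k * ψ y * k⁻¹ = ψ y' :=
    fun y y' => by simp only [hψ]; exact conjClasses_mk_eq_iff_exists_conj L _ v w hw hT y y'
  have hψnil : ∀ y : (cmDatum L 3 (Matrix.of fun i j : Fin 3 => if i.val + j.val + 1 = 3 then (1 : L) else 0)).Local v,
      (((y.val : GL (Fin 3) (UnitaryGroup.LocalRing L v)).val - 1) ^ 3) = 0 →
      (((ψ y : GL (Fin 3) (w.1.adicCompletion L)) : Matrix (Fin 3) (Fin 3) (w.1.adicCompletion L)) - 1) ^ 3 = 0 :=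
    fun y hy => by rw [hψ]; exact conj_localNonsplitEquiv_sub_one_pow_eq_zero L _ v w hw hy
  have hout : ∀ c : ConjClasses ((cmDatum L 3 (Matrix.of fun i j : Fin 3 => if i.val + j.val + 1 = 3 then (1 : L) else 0)).Local v),
      ConjClasses.mk (Quotient.out c) = c := fun c => by
    rw [← ConjClasses.quotient_mk_eq_mk, Quotient.out_eq]
  -- ## 2. the singular classes: `1` or pinned to one of TWO transvections (inert ∕ tamely ramified)
  obtain ⟨na, nb, hsing⟩ : ∃ na nb : GL (Fin 3) (w.1.adicCompletion L), ∀ g : GL (Fin 3) (w.1.adicCompletion L),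
      g ∈ unitaryGroupOfForm (galAdicCompletionMap (L := L) (IsCMField.complexConj L) hw) ((StdForm.antidiagonal 3).over (w.1.adicCompletion L)) →
      ((g : Matrix (Fin 3) (Fin 3) (w.1.adicCompletion L)) - 1) * ((g : Matrix (Fin 3) (Fin 3) (w.1.adicCompletion L)) - 1) = 0 →
      g = 1 ∨
        (∃ k : GL (Fin 3) (w.1.adicCompletion L), k ∈ unitaryGroupOfForm (galAdicCompletionMap (L := L) (IsCMField.complexConj L) hw)
          ((StdForm.antidiagonal 3).over (w.1.adicCompletion L)) ∧ k * g * k⁻¹ = na) ∨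
        (∃ k : GL (Fin 3) (w.1.adicCompletion L), k ∈ unitaryGroupOfForm (galAdicCompletionMap (L := L) (IsCMField.complexConj L) hw)
          ((StdForm.antidiagonal 3).over (w.1.adicCompletion L)) ∧ k * g * k⁻¹ = nb) := by
    by_cases hv : Algebra.IsUnramifiedIn (𝓞 L) v.asIdeal
    · -- inert: `[n(ϖδ)]`, `[n(δ)]`
      obtain ⟨ϖ, hd⟩ := unramifiedLocalConjDatum_adicCompletion (IsCMField.complexConj L) (IsCMField.complexConj_ne_one L) v w hw hv
      have hnormU : ∀ x : w.1.adicCompletion L, galAdicCompletionMap (L := L) (IsCMField.complexConj L) hw x = x → Valued.v x = 1 →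
          ∃ z : w.1.adicCompletion L, z * galAdicCompletionMap (L := L) (IsCMField.complexConj L) hw z = x := fun x hσx hvx =>
        exists_mul_galAdicCompletionMap_eq_of_valued_eq_one (IsCMField.complexConj L) v (IsCMField.complexConj_ne_one L) hcc hv w hw hσx hvx
      obtain ⟨δ, hσδ, hvδ⟩ := exists_galAdicCompletionMap_eq_neg_valued_eq_one (IsCMField.complexConj L) v (IsCMField.complexConj_ne_one L) hcc hv w hw
      obtain ⟨n₀, hn₀⟩ := exists_units_coe_eq_cornerUnipotent' δ
      obtain ⟨n₁, hn₁⟩ := exists_units_coe_eq_cornerUnipotent' (ϖ * δ)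
      exact ⟨n₁, n₀, fun g hg hsq => sq_zero_unipotent_cases (galAdicCompletionMap (L := L) (IsCMField.complexConj L) hw) hd hnormU hσδ hvδ hn₀ hn₁ hg hsq⟩
    · -- tamely ramified: `[n(ϖ)]`, `[n(εϖ)]`
      have he : v.asIdeal.ramificationIdx' w.1.asIdeal ≠ 1 := ramificationIdx'_ne_one_of_not_isUnramifiedIn_of_subsingleton_ufin L hsub w hv
      have h2v : Valued.v (2 : w.1.adicCompletion L) = 1 := valued_two_eq_one_of_isUnit_two_ufin w.1 h2
      obtain ⟨ϖ, hvϖ, hσϖ⟩ := exists_uniformizer_galAdicCompletionMap_eq_neg_of_ramified L (IsCMField.complexConj L) (IsCMField.complexConj_ne_one L) w hw he h2v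
      obtain ⟨ε, -, -, -, -, hdich⟩ := exists_fixed_unit_norm_dichotomy_of_ramified_complexConj L w hw he h2v
      obtain ⟨n₀, hn₀⟩ := exists_units_coe_eq_cornerUnipotent' (ϖ : w.1.adicCompletion L)
      obtain ⟨n₁, hn₁⟩ := exists_units_coe_eq_cornerUnipotent' (ε * (ϖ : w.1.adicCompletion L))
      exact ⟨n₀, n₁, fun g hg hsq => sq_zero_unipotent_cases_of_ramified_complexConj L w hw he h2v hvϖ hσϖ hdich hn₀ hn₁ hg hsq⟩
  -- ## 3. four subsingletons of `ConjClasses G`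
  have hA1 : Set.Subsingleton {c : ConjClasses ((cmDatum L 3 (Matrix.of fun i j : Fin 3 => if i.val + j.val + 1 = 3 then (1 : L) else 0)).Local v) |
      ψ (Quotient.out c) = 1} := by
    intro c hc c' hc'
    simp only [Set.mem_setOf_eq] at hc hc'
    rw [← hout c, ← hout c', hψconj]
    exact ⟨1, one_mem _, by rw [hc, hc', mul_one, inv_one, mul_one]⟩
  have hAa : Set.Subsingleton {c : ConjClasses ((cmDatum L 3 (Matrix.of fun i j : Fin 3 => if i.val + j.val + 1 = 3 then (1 : L) else 0)).Local v) |
      ∃ k : GL (Fin 3) (w.1.adicCompletion L), k ∈ unitaryGroupOfForm (galAdicCompletionMap (L := L) (IsCMField.complexConj L) hw)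
        ((StdForm.antidiagonal 3).over (w.1.adicCompletion L)) ∧ k * ψ (Quotient.out c) * k⁻¹ = na} := by
    intro c hc c' hc'
    obtain ⟨k, hk, hkc⟩ := hc
    obtain ⟨k', hk', hkc'⟩ := hc'
    rw [← hout c, ← hout c', hψconj]
    refine ⟨k'⁻¹ * k, mul_mem (inv_mem hk') hk, ?_⟩
    calc k'⁻¹ * k * ψ (Quotient.out c) * (k'⁻¹ * k)⁻¹ = k'⁻¹ * (k * ψ (Quotient.out c) * k⁻¹) * k' := by group
      _ = k'⁻¹ * (k' * ψ (Quotient.out c') * k'⁻¹) * k' := by rw [hkc, hkc']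
      _ = ψ (Quotient.out c') := by group
  have hAb : Set.Subsingleton {c : ConjClasses ((cmDatum L 3 (Matrix.of fun i j : Fin 3 => if i.val + j.val + 1 = 3 then (1 : L) else 0)).Local v) |
      ∃ k : GL (Fin 3) (w.1.adicCompletion L), k ∈ unitaryGroupOfForm (galAdicCompletionMap (L := L) (IsCMField.complexConj L) hw)
        ((StdForm.antidiagonal 3).over (w.1.adicCompletion L)) ∧ k * ψ (Quotient.out c) * k⁻¹ = nb} := by
    intro c hc c' hc'
    obtain ⟨k, hk, hkc⟩ := hc
    obtain ⟨k', hk', hkc'⟩ := hc'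
    rw [← hout c, ← hout c', hψconj]
    refine ⟨k'⁻¹ * k, mul_mem (inv_mem hk') hk, ?_⟩
    calc k'⁻¹ * k * ψ (Quotient.out c) * (k'⁻¹ * k)⁻¹ = k'⁻¹ * (k * ψ (Quotient.out c) * k⁻¹) * k' := by group
      _ = k'⁻¹ * (k' * ψ (Quotient.out c') * k'⁻¹) * k' := by rw [hkc, hkc']
      _ = ψ (Quotient.out c') := by group
  have hAr : Set.Subsingleton {c : ConjClasses ((cmDatum L 3 (Matrix.of fun i j : Fin 3 => if i.val + j.val + 1 = 3 then (1 : L) else 0)).Local v) |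
      (((ψ (Quotient.out c) : GL (Fin 3) (w.1.adicCompletion L)) : Matrix (Fin 3) (Fin 3) (w.1.adicCompletion L)) - 1) ^ 3 = 0 ∧
      (((ψ (Quotient.out c) : GL (Fin 3) (w.1.adicCompletion L)) : Matrix (Fin 3) (Fin 3) (w.1.adicCompletion L)) - 1) *
        (((ψ (Quotient.out c) : GL (Fin 3) (w.1.adicCompletion L)) : Matrix (Fin 3) (Fin 3) (w.1.adicCompletion L)) - 1) ≠ 0} := by
    intro c hc c' hc'
    obtain ⟨hn, hr⟩ := hc
    obtain ⟨hn', hr'⟩ := hc'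
    rw [← hout c, ← hout c', hψconj]
    exact exists_conj_eq_of_regular_unipotent (galAdicCompletionMap (L := L) (IsCMField.complexConj L) hw) hσσ h2K (hψU _) (hψU _) ⟨3, hn⟩ ⟨3, hn'⟩ hr hr'
  -- ## 4. the unipotent classes lie in the (finite) union of the four subsingletons
  have hfin : Set.Finite {c : ConjClasses ((cmDatum L 3 (Matrix.of fun i j : Fin 3 => if i.val + j.val + 1 = 3 then (1 : L) else 0)).Local v) |
      (((Quotient.out c : ((cmDatum L 3 (Matrix.of fun i j : Fin 3 => if i.val + j.val + 1 = 3 then (1 : L) else 0)).Local v)).val :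
        GL (Fin 3) (UnitaryGroup.LocalRing L v)).val - 1) ^ 3 = 0} := by
    refine (((hA1.finite.union hAa.finite).union hAb.finite).union hAr.finite).subset ?_
    intro c hc
    have h3 := hψnil _ hc
    simp only [Set.mem_union, Set.mem_setOf_eq]
    by_cases hsq : (((ψ (Quotient.out c) : GL (Fin 3) (w.1.adicCompletion L)) : Matrix (Fin 3) (Fin 3) (w.1.adicCompletion L)) - 1) *
        (((ψ (Quotient.out c) : GL (Fin 3) (w.1.adicCompletion L)) : Matrix (Fin 3) (Fin 3) (w.1.adicCompletion L)) - 1) = 0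
    · rcases hsing _ (hψU _) hsq with h | h | h
      · exact Or.inl (Or.inl (Or.inl h))
      · exact Or.inl (Or.inl (Or.inr h))
      · exact Or.inl (Or.inr h)
    · exact Or.inr ⟨h3, hsq⟩
  exact ⟨hfin.toFinset, fun c => by rw [Set.Finite.mem_toFinset, Set.mem_setOf_eq]⟩

end Literature.NumberTheory.Rogawski1990

end
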